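import Mathlib
import HarnessLib
import Literature.Analysis.FluidPDE.Tao2016AveragedNS.CascadeFrontFloors
import Summits.NavierStokesRegularity.NavierStokesRegularity.Theorems.TaoLadderRungTwoBreakNoSurvivingDSSOneLeakyFront

/-!
# Toward the d-UNIFORM THEOREM A′ for crux `TaoLadderRungTwoBreak.NoSurvivingDSSOne` (stmt-NavierStokesRegularity-20205):
# the PROFILE-LEVEL trailing floor for weakly damped fronts (`IsSWave` with `d ≥ 0`, `c₂ ≤ c₁e^{−2dT}`)

MODEL statements about lattice profile systems (Tao 2016 §4; cell vocabulary `IsSWave`, `sEnergy`, `sMass`, `sFlux`, `STable`); nothing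
here concerns the Navier–Stokes equations; no stub, crux or summit is closed (`--supports stmt-NavierStokesRegularity-20205`).

`IsSWave.weighted_trailing_floor_leak`: for a profile family of the `(d, c₁, c₂, T)`-system of an S-table (any real `d`) with
`0 < c₂ ≤ c₁e^{−2dT}` (the SURVIVING side `μ ≤ 1` of the rescaled normal form, where `c₁e^{−2dT}/c₂ = 1/μ`), mass `sMass ≤ M`, mass
integral `≤ A` on every interval, weighted energy `e^{2dx}E` eventually `≤ L`, and parameters `8c₂C_ATδ₀ ≤ 1`,
`4ρ₀A ≤ 1` with the LEAK RATE `ρ₀ = 2(c₁e^{−2dT} − c₂)C_A`: EITHER `e^{2dx}E(x) ≤ 4L` for all `x` (no front), OR there is a phase `a` with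
`sMass(a) ≥ δ₀` and `δ₀² ≤ 8q·(L e^{−2da})·exp((2c₂C_A(M+δ₀) + ρ₀M)T)` — the residue measured from the leading edge `a` is bounded below,
UNIFORMLY in `d` (the tree's Theorem A′ is `d = 0`, `c₁ = c₂ = 1`; its B′-lag floor degenerates like `d²`).  Proof: the weighted energy
`e^{2d(x−a₀)}E` obeys the identity-with-leak of `…LeakyFront` with flux `c₂·e^{2d(x−a₀)}F` and leak `2(c₁e^{−2dT} − c₂)e^{2d(x+T−a₀)}F(x+T)`;
plateau + gap + threshold from that file, with the weight origin put AT the threshold.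
NEXT (not here): feed the rescaled surviving DSS wave (`smallRatio_normalForm`: `d = ε₀`, `c₁ = Λ`, `c₂ = Λ⁻¹`, `τ < 5/2`, `ρ₀ ≤ 2ε₀C_A`)
and convert the floor into `1 − μ ≳ w₀/(C_A·∫sMass)` via Theorem B′ and the wake–throughput identity (`…NoSurvivingDSSOneActionFloor`):
the WIDE-FRONT slice of K1(1) (action up to `≈ 1/(8C_Aε₀)`, floor exponential only in the instantaneous mass).  HONEST LABEL: ⟨20205⟩,
(ρ0) and every NS statement remain OPEN.
-/

noncomputable section

-- the summit and its single sub-problem share the name (CONVENTIONS §1)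
set_option linter.dupNamespace false

namespace Summit.NavierStokesRegularity.NavierStokesRegularity.Theorems.NoSurvivingDSSOne.LeakyFront

open Set Filter Topology MeasureTheory intervalIntegral
open scoped RealInnerProductSpace
open Literature.Analysis.FluidPDE Literature.Analysis.FluidPDE.TaoCascade

variable {V : Type*} [NormedAddCommGroup V] [InnerProductSpace ℝ V]
variable {ρ : Type*} [Fintype ρ]

omit [InnerProductSpace ℝ V] in
/-- `sMass² ≤ q · sEnergy` (Cauchy–Schwarz), `q = card ρ` (public copy of the tree's private lemma). [folklore] -/
theorem sMass_sq_le_card_mul_sEnergy (Φ : ρ → ℝ → V) (x : ℝ) :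
    sMass Φ x ^ 2 ≤ (Fintype.card ρ : ℝ) * sEnergy Φ x := by
  unfold sMass sEnergy
  have := sq_sum_le_card_mul_sum_sq (s := Finset.univ) (f := fun r => ‖Φ r x‖)
  simpa using this

/-- **PROFILE-LEVEL TRAILING FLOOR WITH LEAK** (see the module docstring).
[cite: Tao2016AveragedNS, §4 Lemma 4.1 (4.8)–(4.9) with (4.3) (the lattice energy/flux structure the profile system abstracts); adapted from the cell theorem A′ `IsSWave.trailing_floor` (CascadeFrontFloors)] -/
theorem IsSWave.weighted_trailing_floor_leak {π : Equiv.Perm ρ} {Q A : V → V} {B : V → V → V}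
    {CA d c₁ c₂ T : ℝ} (hS : STable Q A B CA) (hT : 0 < T) (hc₂ : 0 < c₂)
    (hc : c₂ ≤ c₁ * Real.exp (-(2 * d * T))) {Φ : ρ → ℝ → V} (hΦ : IsSWave π Q A B d c₁ c₂ T Φ)
    {M L δ₀ Aint : ℝ} (hM : ∀ x, sMass Φ x ≤ M) (hL : 0 ≤ L)
    (hev : ∃ S₀, ∀ x, S₀ ≤ x → Real.exp (2 * d * x) * sEnergy Φ x ≤ L)
    (hint : ∀ a b, a ≤ b → ∫ x in a..b, sMass Φ x ≤ Aint)
    (hδ₀ : 0 < δ₀) (hCTδ : 8 * (c₂ * CA) * T * δ₀ ≤ 1)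
    (hρA : 4 * (2 * (c₁ * Real.exp (-(2 * d * T)) - c₂) * CA) * Aint ≤ 1) :
    (∀ x, Real.exp (2 * d * x) * sEnergy Φ x ≤ 4 * L) ∨
      ∃ a, δ₀ ≤ sMass Φ a ∧ δ₀ ^ 2 ≤ 8 * (Fintype.card ρ : ℝ) * (L * Real.exp (-(2 * d * a)))
        * Real.exp ((2 * (c₂ * CA) * (M + δ₀) + (2 * (c₁ * Real.exp (-(2 * d * T)) - c₂) * CA) * M) * T) := by
  have hCA := hS.CA_nonneg
  have hM0 : 0 ≤ M := le_trans (sMass_nonneg Φ 0) (hM 0)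
  set q : ℝ := (Fintype.card ρ : ℝ) with hq
  have hq0 : 0 ≤ q := by rw [hq]; positivity
  set κ₁ : ℝ := c₁ * Real.exp (-(2 * d * T)) with hκ₁
  set C : ℝ := c₂ * CA with hCdef
  set ρ₀ : ℝ := 2 * (κ₁ - c₂) * CA with hρ₀def
  set k : ℝ := (2 * C * (M + δ₀) + ρ₀ * M) * T with hkdef
  have hC0 : 0 ≤ C := by rw [hCdef]; positivity
  have hκc : 0 ≤ κ₁ - c₂ := by rw [hκ₁]; linarith
  have hρ₀0 : 0 ≤ ρ₀ := by rw [hρ₀def]; positivity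
  have hk1 : 1 ≤ Real.exp k := Real.one_le_exp (by rw [hkdef]; positivity)
  have ce := hΦ.continuous_sEnergy
  have cF := hΦ.continuous_sFlux hS
  have cM := hΦ.continuous_sMass
  obtain ⟨S₀, hS₀⟩ := hev
  -- the weighted package with the weight origin at `a₀`
  set E : ℝ → ℝ → ℝ := fun a₀ x => Real.exp (2 * d * (x - a₀)) * sEnergy Φ x with hE
  set F : ℝ → ℝ → ℝ := fun a₀ x => c₂ * (Real.exp (2 * d * (x - a₀)) * sFlux π A T Φ x) with hF
  set R : ℝ → ℝ → ℝ := fun a₀ x =>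
    2 * (κ₁ - c₂) * (Real.exp (2 * d * (x + T - a₀)) * sFlux π A T Φ (x + T)) with hR
  have hderivP : ∀ a₀ s, HasDerivAt (E a₀) (2 * (F a₀ (s + T) - F a₀ s) + R a₀ s) s := by
    intro a₀ s
    have h1 : HasDerivAt (fun x => Real.exp (2 * d * (x - a₀))) (Real.exp (2 * d * (s - a₀)) * (2 * d * 1)) s := by
      have : HasDerivAt (fun x => 2 * d * (x - a₀)) (2 * d * 1) s := by
        simpa using ((hasDerivAt_id s).sub_const a₀).const_mul (2 * d)
      exact this.exp
    refine (h1.mul (hasDerivAt_sEnergy hS hΦ s)).congr_deriv ?_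
    have ex1 : Real.exp (2 * d * (s + T - a₀)) = Real.exp (2 * d * (s - a₀)) * Real.exp (2 * d * T) := by
      rw [← Real.exp_add]; congr 1; ring
    have ex2 : Real.exp (-(2 * d * T)) * Real.exp (2 * d * T) = 1 := by
      rw [Real.exp_neg, inv_mul_cancel₀ (Real.exp_pos _).ne']
    simp only [hF, hR, hκ₁, ex1]
    linear_combination (-(2 * c₁ * Real.exp (2 * d * (s - a₀)) * sFlux π A T Φ (s + T))) * ex2
  have hfluxP : ∀ a₀ σ, |F a₀ σ| ≤ C * E a₀ σ * sMass Φ (σ - T) := by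
    intro a₀ σ
    have hw := Real.exp_pos (2 * d * (σ - a₀))
    simp only [hF, hE, hCdef]
    rw [abs_mul, abs_of_pos hc₂, abs_mul, abs_of_pos hw]
    calc c₂ * (Real.exp (2 * d * (σ - a₀)) * |sFlux π A T Φ σ|)
        ≤ c₂ * (Real.exp (2 * d * (σ - a₀)) * (CA * sEnergy Φ σ * sMass Φ (σ - T))) :=
          mul_le_mul_of_nonneg_left (mul_le_mul_of_nonneg_left (abs_sFlux_le hS π T Φ σ) hw.le) hc₂.le
      _ = c₂ * CA * (Real.exp (2 * d * (σ - a₀)) * sEnergy Φ σ) * sMass Φ (σ - T) := by ring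
  have hrP : ∀ a₀ s, |R a₀ s| ≤ ρ₀ * E a₀ (s + T) * sMass Φ s := by
    intro a₀ s
    have hw := Real.exp_pos (2 * d * (s + T - a₀))
    simp only [hR, hE, hρ₀def]
    rw [abs_mul, abs_of_nonneg (by positivity : (0:ℝ) ≤ 2 * (κ₁ - c₂)), abs_mul, abs_of_pos hw]
    have h := abs_sFlux_le hS π T Φ (s + T)
    rw [add_sub_cancel_right] at h
    calc 2 * (κ₁ - c₂) * (Real.exp (2 * d * (s + T - a₀)) * |sFlux π A T Φ (s + T)|)
        ≤ 2 * (κ₁ - c₂) * (Real.exp (2 * d * (s + T - a₀)) * (CA * sEnergy Φ (s + T) * sMass Φ s)) :=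
          mul_le_mul_of_nonneg_left (mul_le_mul_of_nonneg_left h hw.le) (by positivity)
      _ = 2 * (κ₁ - c₂) * CA * (Real.exp (2 * d * (s + T - a₀)) * sEnergy Φ (s + T)) * sMass Φ s := by ring
  have hEcont : ∀ a₀, Continuous (E a₀) := fun a₀ => by simp only [hE]; fun_prop
  have hFcont : ∀ a₀, Continuous (F a₀) := fun a₀ => by simp only [hF]; fun_prop
  have hRcont : ∀ a₀, Continuous (R a₀) := fun a₀ => by
    have : Continuous fun x => sFlux π A T Φ (x + T) := cF.comp (continuous_id.add continuous_const)
    simp only [hR]; fun_prop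
  have hEnn : ∀ a₀ s, 0 ≤ E a₀ s := fun a₀ s => by simp only [hE]; exact mul_nonneg (Real.exp_pos _).le (sEnergy_nonneg Φ s)
  -- the trailing level seen from `a₀`
  have hEev : ∀ a₀ x, S₀ ≤ x → E a₀ x ≤ L * Real.exp (-(2 * d * a₀)) := by
    intro a₀ x hx
    have e1 : Real.exp (2 * d * (x - a₀)) = Real.exp (2 * d * x) * Real.exp (-(2 * d * a₀)) := by
      rw [← Real.exp_add]; congr 1; ring
    simp only [hE]
    rw [e1, mul_right_comm]
    exact mul_le_mul_of_nonneg_right (hS₀ x hx) (Real.exp_pos _).le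
  have hfreq : ∀ a₀ S₁, ∃ S', S₁ ≤ S' ∧ E a₀ S' ≤ L * Real.exp (-(2 * d * a₀)) :=
    fun a₀ S₁ => ⟨max S₁ S₀, le_max_left _ _, hEev a₀ _ (le_max_right _ _)⟩
  have hbd : ∀ a₀ s₁, ∃ B', ∀ s, s₁ ≤ s → E a₀ s ≤ B' := by
    intro a₀ s₁
    obtain ⟨x₀, _, hx₀⟩ := (isCompact_Icc (a := s₁) (b := max s₁ S₀)).exists_isMaxOn
      (nonempty_Icc.mpr (le_max_left _ _)) (hEcont a₀).continuousOn
    refine ⟨max (E a₀ x₀) (L * Real.exp (-(2 * d * a₀))), fun s hs => ?_⟩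
    by_cases h : s ≤ max s₁ S₀
    · exact le_trans (hx₀ ⟨hs, h⟩) (le_max_left _ _)
    · push Not at h
      exact le_trans (hEev a₀ s (le_trans (le_max_right _ _) h.le)) (le_max_right _ _)
  -- CASE 1: the mass exceeds `δ₀` somewhere in the trailing region — the floor is immediate
  by_cases hbig : ∃ x, S₀ ≤ x ∧ δ₀ < sMass Φ x
  · obtain ⟨x, hx, hδx⟩ := hbig
    refine Or.inr ⟨x, hδx.le, ?_⟩
    have h1 : δ₀ ^ 2 ≤ sMass Φ x ^ 2 := by nlinarith [hδx, hδ₀]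
    have h2 := sMass_sq_le_card_mul_sEnergy Φ x
    have h3 : sEnergy Φ x ≤ L * Real.exp (-(2 * d * x)) := by
      have := hEev x x hx
      simp only [hE, sub_self, mul_zero, Real.exp_zero, one_mul] at this
      exact this
    have h4 : q * sEnergy Φ x ≤ q * (L * Real.exp (-(2 * d * x))) := mul_le_mul_of_nonneg_left h3 hq0
    have h5 : 0 ≤ q * (L * Real.exp (-(2 * d * x))) := by positivity
    have h6 : q * (L * Real.exp (-(2 * d * x))) ≤ 8 * q * (L * Real.exp (-(2 * d * x))) * Real.exp k := by
      nlinarith [mul_le_mul_of_nonneg_left hk1 h5]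
    rw [← hq] at h2
    linarith [h1, h2, h4, h6]
  push Not at hbig
  -- CASE 2: `sMass ≤ δ₀` on `[S₀, ∞)`: threshold alternative
  rcases threshold_point' cM hbig with hall | ⟨a, ha, hga⟩
  · -- no threshold: plateau everywhere for the weight origin 0
    refine Or.inl fun x => ?_
    obtain ⟨B', hB'⟩ := hbd 0 x
    have h := plateau_of_small_mass_leak hT hC0 hCTδ hρ₀0 hρA (hFcont 0) (hRcont 0) cM (hEnn 0) (sMass_nonneg Φ)
      (hderivP 0) (hfluxP 0) (hrP 0) hint (fun u _ => hall u) hB' (hfreq 0) x le_rfl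
    simp only [hE, sub_zero, mul_zero, neg_zero, Real.exp_zero, mul_one] at h
    exact h
  · -- threshold at `a`: weight origin at `a`, plateau on `[a+T, ∞)`, gap on `[a, a+T]`
    refine Or.inr ⟨a, hga, ?_⟩
    obtain ⟨B', hB'⟩ := hbd a (a + T)
    have hplat : ∀ s, a + T ≤ s → E a s ≤ 4 * (L * Real.exp (-(2 * d * a))) :=
      plateau_of_small_mass_leak hT hC0 hCTδ hρ₀0 hρA (hFcont a) (hRcont a) cM (hEnn a) (sMass_nonneg Φ)
        (hderivP a) (hfluxP a) (hrP a) hint (fun u hu => ha u (by linarith)) hB' (hfreq a)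
    have hgap := gap_bound_leak hT hC0 hδ₀.le hM0 (by positivity : (0:ℝ) ≤ 4 * (L * Real.exp (-(2 * d * a)))) hρ₀0
      (hEcont a) (hEnn a) (sMass_nonneg Φ) (hderivP a) (hfluxP a) (hrP a) ha hM hplat a le_rfl (by linarith)
    have hEa : E a a = sEnergy Φ a := by simp only [hE, sub_self, mul_zero, Real.exp_zero, one_mul]
    rw [hEa] at hgap
    have h1 : δ₀ ^ 2 ≤ sMass Φ a ^ 2 := by nlinarith [hga, hδ₀]
    have h2 := sMass_sq_le_card_mul_sEnergy Φ a
    have h3 : q * sEnergy Φ a ≤ q * (2 * (4 * (L * Real.exp (-(2 * d * a)))) * Real.exp k) :=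
      mul_le_mul_of_nonneg_left hgap hq0
    rw [← hq] at h2
    linarith

end Summit.NavierStokesRegularity.NavierStokesRegularity.Theorems.NoSurvivingDSSOne.LeakyFront

end
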